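import Summits.AtomisticToContinuum.HydrodynamicLimit.Theorems.OneFlightGossipEngineEnergyCurrentTailsFirstPartnerObjects
import HarnessLib

/-!
# Crux `EnergyCurrentTails` (stmt-AtomisticToContinuum-9235), line `quartic-schur-ledger`, rung-0 certificate of I′:
# S3, the FLIGHT TRANSFER `shareRung0_flightTransfer` (helper file, `--supports stmt-AtomisticToContinuum-9235`)

Sure kinematics on `𝕋³ × ℝ³`.  Fix `n` labelled point particles `w`, a diameter `ε`, a look-ahead `Δ`, a forward
free-flight duration `t ≥ 0`, two labels `e`, `k`, a nonnegative configuration mark `F₀ (x) (y) (v) (v')` dominated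
by a velocity weight `m v v'`.  Then the marked sum (`EnergyCurrentTailsFirstPartner.pairSum`, marks read at the
predicted datum) over the would-be pairs `p` of the flown configuration `freeFlight t w` (look-ahead `Δ`) with
`(p.1 = e ∧ p.2 ≠ k) ∨ (p.2 = e ∧ p.1 ≠ k)` is at most

  `Σ_o 𝟙{o ∉ {e, k}} (𝟙{(e, o) ∈ W} m v_e v_o + 𝟙{(o, e) ∈ W} m v_o v_e)`,  `W = wouldBePairs ε (Δ + t) w`.

**Proof.**  (1) `wouldBePairs ε Δ (freeFlight t w) ⊆ wouldBePairs ε (Δ + t) w`: a contact witness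
`u ∈ (0, Δ]` of the flown configuration is the witness `u + t ∈ (0, Δ + t]` of `w`, since free flight is a
one-parameter group (`freeFlight_add`).  (2) Velocities are unchanged by free flight, so each mark is
`≤ m v_{p.1} v_{p.2}`, and `m ≥ 0` (it dominates `F₀ ≥ 0`).  (3) Every pair of the filter is `(e, o)` or `(o, e)`
with `o ∉ {e, k}` (would-be pairs have distinct endpoints); summing fiberwise along `p ↦ o` (the endpoint
different from `e`), each fiber is contained in `{(e, o), (o, e)}`, and is empty when `o ∈ {e, k}`.

References: Gallagher–Saint-Raymond–Texier 2013 §4.1 (collision cylinders on hard-sphere trajectories); elementary.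
-/

noncomputable section

open scoped BigOperators Classical ENNReal InnerProductSpace
open MeasureTheory Set Filter
open Literature.Analysis.FluidPDE Literature.MathematicalPhysics.KineticTheory

namespace Summit.AtomisticToContinuum.HydrodynamicLimit.Theorems

namespace QuarticSchurLedger

open EnergyCurrentTailsFirstPartner RateFloorLine

variable {n : ℕ}

/-! ## Would-be pairs along a forward free flight -/

/-- Would-be pairs of a forward free flight of duration `t ≥ 0` with look-ahead `Δ` are would-be pairs of the
original configuration with look-ahead `Δ + t` (free flight is a one-parameter group). [folklore] -/
theorem wouldBePairs_freeFlight_subset {ε Δ t : ℝ} (ht : 0 ≤ t) (w : Config n (Fin 3) T3) :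
    wouldBePairs ε Δ (freeFlight (Torus.geometry (Fin 3)) t w) ⊆ wouldBePairs ε (Δ + t) w := by
  intro p hp
  simp only [wouldBePairs, Finset.mem_filter, Finset.mem_univ, true_and] at hp ⊢
  obtain ⟨hne, u, hu, hle⟩ := hp
  refine ⟨hne, u + t, ⟨by linarith [hu.1], by linarith [hu.2]⟩, ?_⟩
  simpa only [← freeFlight_add] using hle

/-! ## The star-shaped pair filter is dominated by a sum over the free endpoint -/

/-- If every pair `p` of a set `S` of ordered pairs of DISTINCT labels satisfies
`(p.1 = e ∧ p.2 ≠ k) ∨ (p.2 = e ∧ p.1 ≠ k)`, then `S` consists of pairs `(e, o)`, `(o, e)` with `o ∉ {e, k}`,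
each at most once: a nonnegative sum over `S` is at most `Σ_o 𝟙{o ∉ {e, k}} (g (e, o) + g (o, e))`. [folklore] -/
theorem sum_starPairs_le {S : Finset (Fin n × Fin n)} {e k : Fin n} (g : Fin n × Fin n → ℝ)
    (hg : ∀ p, 0 ≤ g p) (hS : ∀ p ∈ S, p.1 ≠ p.2 ∧ ((p.1 = e ∧ p.2 ≠ k) ∨ (p.2 = e ∧ p.1 ≠ k))) :
    ∑ p ∈ S, g p ≤ ∑ o : Fin n, (if o ≠ e ∧ o ≠ k then g (e, o) + g (o, e) else 0) := by
  -- the free endpoint `φ p` (the endpoint different from `e`)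
  obtain ⟨φ, hφ⟩ : ∃ φ : Fin n × Fin n → Fin n, ∀ p, φ p = if p.1 = e then p.2 else p.1 := ⟨_, fun _ => rfl⟩
  -- on `S`: `p = (e, φ p)` or `p = (φ p, e)`, and `φ p ∉ {e, k}`
  have hφS : ∀ p ∈ S, (p = (e, φ p) ∨ p = (φ p, e)) ∧ φ p ≠ e ∧ φ p ≠ k := by
    intro p hp
    obtain ⟨hne, h⟩ := hS p hp
    rcases h with ⟨h1, hk⟩ | ⟨h2, hk⟩
    · have hφp : φ p = p.2 := by rw [hφ, if_pos h1]
      refine ⟨Or.inl ?_, ?_, ?_⟩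
      · rw [hφp, ← h1]
      · rw [hφp]
        exact fun h => hne (h1.trans h.symm)
      · rwa [hφp]
    · have h1 : p.1 ≠ e := fun h1 => hne (h1.trans h2.symm)
      have hφp : φ p = p.1 := by rw [hφ, if_neg h1]
      refine ⟨Or.inr ?_, ?_, ?_⟩
      · rw [hφp, ← h2]
      · rwa [hφp]
      · rwa [hφp]
  rw [← Finset.sum_fiberwise S φ g]
  refine Finset.sum_le_sum fun o _ => ?_
  split_ifs with ho
  · -- the fiber over `o ∉ {e, k}` is contained in `{(e, o), (o, e)}`
    have hsub : (S.filter fun p => φ p = o) ⊆ {(e, o), (o, e)} := by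
      intro p hp
      rw [Finset.mem_filter] at hp
      obtain ⟨hpS, hpo⟩ := hp
      rw [Finset.mem_insert, Finset.mem_singleton, ← hpo]
      exact (hφS p hpS).1
    have hne : (e, o) ≠ (o, e) := fun h => ho.1 (Prod.mk_inj.1 h).2
    calc ∑ p ∈ S.filter (fun p => φ p = o), g p ≤ ∑ p ∈ ({(e, o), (o, e)} : Finset (Fin n × Fin n)), g p :=
          Finset.sum_le_sum_of_subset_of_nonneg hsub fun p _ _ => hg p
      _ = g (e, o) + g (o, e) := Finset.sum_pair hne
  · -- the fiber over `o ∈ {e, k}` is empty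
    refine (Finset.sum_eq_zero fun p hp => ?_).le
    rw [Finset.mem_filter] at hp
    obtain ⟨hpS, hpo⟩ := hp
    exact absurd (hpo ▸ (hφS p hpS).2) ho

/-! ## S3 · the flight transfer -/

/-- **S3 · would-be pairs along a forward free flight; marks bounded by a velocity weight.**  For `t ≥ 0`, the
marked sum (time-independent configuration marks `0 ≤ F₀ ≤ m`, `m` a velocity weight) over the would-be pairs of
`freeFlight t w` (look-ahead `Δ`) touching `e` but not equal to `{e, k}` is at most the `m`-weighted count over
`o ∉ {e, k}` of the would-be pairs `(e, o)`, `(o, e)` of `w` with look-ahead `Δ + t`. [folklore] -/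
theorem shareRung0_flightTransfer : ∀ {n : ℕ} (ε Δ t : ℝ) (w : Config n (Fin 3) T3) (e k : Fin n) (F₀ : T3 → T3 → V3 → V3 → ℝ) (m : V3 → V3 → ℝ), 0 < Δ → 0 ≤ t → (∀ x y v v', 0 ≤ F₀ x y v v') → (∀ x y v v', F₀ x y v v' ≤ m v v') → pairSum ε Δ (freeFlight (Torus.geometry (Fin 3)) t w) 0 (fun _ => F₀) ((wouldBePairs ε Δ (freeFlight (Torus.geometry (Fin 3)) t w)).filter fun p => (p.1 = e ∧ p.2 ≠ k) ∨ (p.2 = e ∧ p.1 ≠ k)) ≤ ∑ o : Fin n, (if o ≠ e ∧ o ≠ k then ((if (e, o) ∈ wouldBePairs ε (Δ + t) w then m (w e).2 (w o).2 else 0) + (if (o, e) ∈ wouldBePairs ε (Δ + t) w then m (w o).2 (w e).2 else 0)) else 0) := by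
  intro n ε Δ t w e k F₀ m _ ht hF₀ hFm
  -- `m ≥ 0` since it dominates `F₀ ≥ 0`
  have hm0 : ∀ v v', 0 ≤ m v v' := fun v v' => (hF₀ (w e).1 (w e).1 v v').trans (hFm (w e).1 (w e).1 v v')
  have hsub := wouldBePairs_freeFlight_subset (ε := ε) (Δ := Δ) ht w
  refine le_trans (b := ∑ p ∈ (wouldBePairs ε Δ (freeFlight (Torus.geometry (Fin 3)) t w)).filter
      fun p => (p.1 = e ∧ p.2 ≠ k) ∨ (p.2 = e ∧ p.1 ≠ k),
    (if p ∈ wouldBePairs ε (Δ + t) w then m (w p.1).2 (w p.2).2 else 0)) ?_ ?_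
  · -- termwise: velocities are unchanged by free flight, `F₀ ≤ m`, and the pair is would-be for `Δ + t`
    unfold pairSum
    refine Finset.sum_le_sum fun p hp => ?_
    rw [if_pos (hsub (Finset.mem_filter.1 hp).1)]
    exact hFm _ _ _ _
  · -- the star-shaped filter, fiberwise over the free endpoint
    refine sum_starPairs_le (fun p => if p ∈ wouldBePairs ε (Δ + t) w then m (w p.1).2 (w p.2).2 else 0)
      (fun p => ?_) (fun p hp => ?_)
    · show 0 ≤ (if p ∈ wouldBePairs ε (Δ + t) w then m (w p.1).2 (w p.2).2 else 0)
      split_ifs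
      · exact hm0 _ _
      · exact le_rfl
    · have hp' := Finset.mem_filter.1 hp
      have hW := hp'.1
      simp only [wouldBePairs, Finset.mem_filter, Finset.mem_univ, true_and] at hW
      exact ⟨hW.1, hp'.2⟩

end QuarticSchurLedger

end Summit.AtomisticToContinuum.HydrodynamicLimit.Theorems

end
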